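import Summits.NavierStokesRegularity.NavierStokesRegularity.Theses.AxisymmetricExtremality
import Literature.Analysis.FluidPDE.SereginSverakAxisymmetric
import Literature.Analysis.FluidPDE.NewtonKernel
import HarnessLib

/-!
# Seregin 2022, §2 Step 1: the product cut-off `ζ = φ(ϱ)ψ(x₃)` adapted to two regular heights —
# crux stmt-NavierStokesRegularity-15453 (`AxisymmetricExtremality.AxisymmetricKatoGlobal`), line registered, support for stub `stub_sereginLogSwirlOrigin`

Support file (`--supports stmt-NavierStokesRegularity-15453`; theorems only, everything proved)
toward the registered stub `stub_sereginLogSwirlOrigin` = the named fact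
`Literature.Analysis.FluidPDE.seregin2022_logSwirl_regularAtOrigin` (G. Seregin, J. Math. Fluid
Mech. 24 (2022), Paper 27 = arXiv:2201.00153, §2).  Step 1 (arXiv p. 5) fixes "a smooth cut-off
function `η(r, x₃, t) = φ(r)ψ(x₃)ξ(t)`" with `φ = 1` for `r < 1/2`, `φ = 0` for `r ≥ 5/6`,
`ψ = 1` for `0 ≤ x₃ < 1/2`, `ψ = 0` for `x₃ ≥ 5/6`, all valued in `[0, 1]`, adapted to the partial
regularity of `v`: `v` is smooth "in the set `supp |∇η|`" — off the axis where `φ' ≠ 0`, and near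
the two regular axis points `(0, h₁, 0)`, `(0, -h₂, 0)` where `ψ' ≠ 0`.  In the tree's reduction
of the fact to its classical core (`seregin2022_logSwirl_regularAtOrigin_of_cleanRepr`,
`…FinalReduction.lean`) the configuration at the normalised position `(0, 1)` consists of two
heights `h₋ < 0 < h₊` and a width `δ > 0` with `-1 ≤ h₋ - δ`, `h₋ + δ < 0 < h₊ - δ`, `h₊ + δ ≤ 1`,
every top-slice point of `𝒞 = 𝒞(0, 1)` off the axis or of height within `δ` of `h₊` or `h₋`
being regular; and on the final slab the time factor is `ξ = 1`.  This file constructs the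
time-independent spatial cut-off for that configuration and records the bookkeeping of its
support and of the support of its gradient:

* `radialFactor_props` — `φ(x) = Θ_{ρ₁,ρ₂}(x₀² + x₁²)` (`Θ = cutoffProfile`, the profile of the
  tree's `radialCutoff`, in the variable `ϱ²`, so that no non-smoothness of `ϱ` at the axis
  enters): `C^∞`, valued in `[0, 1]`, `= 1` for `ϱ ≤ ρ₁`, `= 0` for `ϱ ≥ ρ₂`, rotation invariant;
* `axialFactor_props` — `ψ(x) = Θ_{a,b}((x₃ - c)²)`: `C^∞`, valued in `[0, 1]`, `= 1` for
  `|x₃ - c| ≤ a`, `= 0` for `|x₃ - c| ≥ b`, rotation invariant;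
* `fderiv_eq_zero_of_eqOn_isOpen` — a function constant on an open set has zero derivative there;
* `exists_step1_cutoff` (registered sub-goal) — **the cut-off**: for `0 < ρ₁ < ρ₂ < 1` and
  heights/width as above there is `ζ : ℝ³ → ℝ`, `C^∞`, axisymmetric, compactly supported,
  `0 ≤ ζ ≤ 1`, `ζ = 1` on the closed box `{ϱ ≤ ρ₁, h₋ + δ/2 ≤ x₃ ≤ h₊ - δ/2}` (which contains
  `𝒞(r)` for small `r`, `spaceCyl_subset_box`), `ζ ≠ 0` only in the open box
  `{ϱ < ρ₂, h₋ - δ/2 < x₃ < h₊ + δ/2}`, `tsupport ζ ⊆ {ϱ ≤ ρ₂, h₋ - δ/2 ≤ x₃ ≤ h₊ + δ/2} ⊆ 𝒞`,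
  and **`supp ∇ζ` lies in the regular region**:
  `tsupport (∇ζ) ⊆ {ϱ ≤ ρ₂, h₋ - δ/2 ≤ x₃ ≤ h₊ + δ/2} ∩ ({ρ₁ ≤ ϱ} ∪ {|x₃ - h₊| ≤ δ/2} ∪ {|x₃ - h₋| ≤ δ/2})`
  (so every point of it is off the axis or strictly within `δ` of a height);
* `spaceCyl_subset_box`, `good_of_mem_gradBox`, `gradBox_subset_spaceCyl`, `isCompact_gradBox` —
  the elementary geometry used downstream (Step 3's far field `{ϱ ≥ r₁}` and `supp ∇ζ` are
  compact sets of regular top-slice points inside `𝒞`).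

## Mathlib / tree search

Tree: `cutoffProfile`, `cutoffProfile_contDiff/_nonneg/_le_one/_eq_one/_eq_zero`
(`NewtonKernel`), `cylRadius_sq`, `cylRadius_rotZ`, `rotZ_apply_two`, `continuous_cylRadius`
(`AxisymmetricEuler`), `SereginSverak2009.spaceCyl`, `mem_spaceCyl`, `spaceCyl_subset_ball`
(`SereginSverakAxisymmetric`); siblings `Seregin2020.axisCutoff_props`, `productCutoff_props`
(`Seregin2020SwirlMoserCutoffs`, cut-offs vanishing AT the axis — not the shape needed here),
`exists_cylindrical_cutoff` (`PeriodicCylinderNeumannInterior`, radial factor only).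
Mathlib: `Filter.EventuallyEq.fderiv_eq`, `fderiv_const_apply`, `tsupport_fderiv_subset`,
`closure_minimal`, `isClosed_le`. `lean search 'step1_cutoff|exists_productCutoff' --decl`: no
matches (2026-08-17).

## References

* G. Seregin, J. Math. Fluid Mech. 24 (2022), Paper No. 27 = arXiv:2201.00153, §2 Step 1 (arXiv
  p. 5: the cut-off `η = φ(r)ψ(x₃)ξ(t)` and `supp |∇η|`). [`Seregin2022LocalAxisym`]
-/

noncomputable section

open Set Filter Topology Function Metric
open scoped ContDiff
open Literature.Analysis.FluidPDE

-- `<Problem> = <Summit>` duplicates a namespace component by design (lakefile sets the same option).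
set_option linter.dupNamespace false

namespace Summit.NavierStokesRegularity.NavierStokesRegularity.Theorems.AxisymmetricKatoGlobal.EulerScaling

/-! ### The two factors -/

section Factors

/-- **A function constant on an open set has zero derivative there.** [folklore] -/
theorem fderiv_eq_zero_of_eqOn_isOpen {f : EuclideanSpace ℝ (Fin 3) → ℝ} {O : Set (EuclideanSpace ℝ (Fin 3))}
    (hO : IsOpen O) {c : ℝ} (hf : ∀ y ∈ O, f y = c) {x : EuclideanSpace ℝ (Fin 3)} (hx : x ∈ O) :
    fderiv ℝ f x = 0 := by
  have hev : f =ᶠ[𝓝 x] fun _ => c := by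
    filter_upwards [hO.mem_nhds hx] with y hy using hf y hy
  rw [hev.fderiv_eq]
  exact fderiv_const_apply c

/-- **The radial factor `φ(x) = Θ_{ρ₁,ρ₂}(x₀² + x₁²)`** (Seregin: "`φ(r) = 1` if `0 ≤ r < 1/2`;
`φ(r) = 0` if `r ≥ 5/6`", here with general radii `0 < ρ₁ < ρ₂`): `C^∞` (a smooth profile of the
polynomial `x₀² + x₁² = ϱ²`), valued in `[0, 1]`, `φ = 1` for `ϱ ≤ ρ₁`, `φ = 0` for `ρ₂ ≤ ϱ`, and
invariant under the rotations `R_θ` about the axis. [cite: Seregin2022LocalAxisym, §2 Step 1 (arXiv:2201.00153 p. 5), the factor φ] -/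
theorem radialFactor_props {ρ₁ ρ₂ : ℝ} (h₁ : 0 < ρ₁) (h₁₂ : ρ₁ < ρ₂)
    {φ : EuclideanSpace ℝ (Fin 3) → ℝ} (hφ : ∀ x, φ x = cutoffProfile ρ₁ ρ₂ (x 0 ^ 2 + x 1 ^ 2)) :
    ContDiff ℝ ∞ φ ∧ (∀ x, 0 ≤ φ x ∧ φ x ≤ 1) ∧ (∀ x, cylRadius x ≤ ρ₁ → φ x = 1) ∧
      (∀ x, ρ₂ ≤ cylRadius x → φ x = 0) ∧ (∀ θ x, φ (rotZ θ x) = φ x) := by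
  have hfun : φ = fun x => cutoffProfile ρ₁ ρ₂ (x 0 ^ 2 + x 1 ^ 2) := funext hφ
  have hsq : ContDiff ℝ ∞ fun y : EuclideanSpace ℝ (Fin 3) => y 0 ^ 2 + y 1 ^ 2 :=
    ((contDiff_piLp_apply (𝕜 := ℝ) (p := 2) (i := (0 : Fin 3))).pow 2).add
      ((contDiff_piLp_apply (𝕜 := ℝ) (p := 2) (i := (1 : Fin 3))).pow 2)
  refine ⟨?_, fun x => ?_, fun x hx => ?_, fun x hx => ?_, fun θ x => ?_⟩
  · rw [hfun]
    exact (cutoffProfile_contDiff ρ₁ ρ₂).comp hsq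
  · rw [hφ]
    exact ⟨cutoffProfile_nonneg _ _ _, cutoffProfile_le_one _ _ _⟩
  · rw [hφ, ← cylRadius_sq]
    exact cutoffProfile_eq_one h₁.le h₁₂ (pow_le_pow_left₀ (cylRadius_nonneg x) hx 2)
  · rw [hφ, ← cylRadius_sq]
    exact cutoffProfile_eq_zero h₁.le h₁₂ (pow_le_pow_left₀ (h₁.le.trans h₁₂.le) hx 2)
  · rw [hφ, hφ, ← cylRadius_sq, ← cylRadius_sq, cylRadius_rotZ]

/-- **The axial factor `ψ(x) = Θ_{a,b}((x₃ - c)²)`** (Seregin: "`ψ(x₃) = 1` if `0 ≤ x₃ < 1/2`;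
`ψ(x₃) = 0` if `x₃ ≥ 5/6`", here centred at `c` with plateau half-width `a` and outer half-width
`b`, `0 ≤ a < b`): `C^∞`, valued in `[0, 1]`, `ψ = 1` for `|x₃ - c| ≤ a`, `ψ = 0` for
`b ≤ |x₃ - c|`, and invariant under the rotations about the axis (they fix `x₃`). [cite: Seregin2022LocalAxisym, §2 Step 1 (arXiv:2201.00153 p. 5), the factor ψ] -/
theorem axialFactor_props {a b c : ℝ} (ha : 0 ≤ a) (hab : a < b)
    {ψ : EuclideanSpace ℝ (Fin 3) → ℝ} (hψ : ∀ x, ψ x = cutoffProfile a b ((x 2 - c) ^ 2)) :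
    ContDiff ℝ ∞ ψ ∧ (∀ x, 0 ≤ ψ x ∧ ψ x ≤ 1) ∧ (∀ x, |x 2 - c| ≤ a → ψ x = 1) ∧
      (∀ x, b ≤ |x 2 - c| → ψ x = 0) ∧ (∀ θ x, ψ (rotZ θ x) = ψ x) := by
  have hfun : ψ = fun x => cutoffProfile a b ((x 2 - c) ^ 2) := funext hψ
  have hsq : ContDiff ℝ ∞ fun y : EuclideanSpace ℝ (Fin 3) => (y 2 - c) ^ 2 :=
    ((contDiff_piLp_apply (𝕜 := ℝ) (p := 2) (i := (2 : Fin 3))).sub contDiff_const).pow 2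
  refine ⟨?_, fun x => ?_, fun x hx => ?_, fun x hx => ?_, fun θ x => ?_⟩
  · rw [hfun]
    exact (cutoffProfile_contDiff a b).comp hsq
  · rw [hψ]
    exact ⟨cutoffProfile_nonneg _ _ _, cutoffProfile_le_one _ _ _⟩
  · rw [hψ, ← sq_abs]
    exact cutoffProfile_eq_one ha hab (pow_le_pow_left₀ (abs_nonneg _) hx 2)
  · rw [hψ, ← sq_abs]
    exact cutoffProfile_eq_zero ha hab (pow_le_pow_left₀ (ha.trans hab.le) hx 2)
  · rw [hψ, hψ, rotZ_apply_two]

end Factors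

/-! ### Elementary geometry of the boxes -/

section Geometry

/-- **`𝒞(r)` lies in the plateau box**: if `0 < r ≤ ρ₁`, `r ≤ h₊ - δ/2` and `r ≤ -(h₋ + δ/2)`,
then every `x ∈ 𝒞(0, r)` has `ϱ(x) ≤ ρ₁` and `h₋ + δ/2 ≤ x₃ ≤ h₊ - δ/2`. [folklore] -/
theorem spaceCyl_subset_box {ρ₁ hp hm δ r : ℝ} (hr₁ : r ≤ ρ₁) (hrp : r ≤ hp - δ / 2)
    (hrm : r ≤ -(hm + δ / 2)) {x : EuclideanSpace ℝ (Fin 3)}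
    (hx : x ∈ SereginSverak2009.spaceCyl (0 : EuclideanSpace ℝ (Fin 3)) r) :
    cylRadius x ≤ ρ₁ ∧ hm + δ / 2 ≤ x 2 ∧ x 2 ≤ hp - δ / 2 := by
  rw [SereginSverak2009.mem_spaceCyl, sub_zero] at hx
  obtain ⟨h1, h2⟩ := hx
  have h2' : |x 2| < r := by simpa using h2
  obtain ⟨hl, hu⟩ := abs_lt.1 h2'
  exact ⟨h1.le.trans hr₁, by linarith, by linarith⟩

/-- **Points of the gradient box are regular top-slice points**: if `0 < ρ₁` and
`ρ₁ ≤ ϱ(x) ∨ |x₃ - h₊| ≤ δ/2 ∨ |x₃ - h₋| ≤ δ/2` with `δ > 0`, then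
`0 < ϱ(x) ∨ |x₃ - h₊| < δ ∨ |x₃ - h₋| < δ` (the disjunction of the core hypothesis of
`seregin2022_logSwirl_regularAtOrigin_of_cleanRepr`). [folklore] -/
theorem good_of_mem_gradBox {ρ₁ hp hm δ : ℝ} (h₁ : 0 < ρ₁) (hδ : 0 < δ) {x : EuclideanSpace ℝ (Fin 3)}
    (hx : ρ₁ ≤ cylRadius x ∨ |x 2 - hp| ≤ δ / 2 ∨ |x 2 - hm| ≤ δ / 2) :
    0 < cylRadius x ∨ |x 2 - hp| < δ ∨ |x 2 - hm| < δ := by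
  rcases hx with h | h | h
  · exact Or.inl (h₁.trans_le h)
  · exact Or.inr (Or.inl (h.trans_lt (by linarith)))
  · exact Or.inr (Or.inr (h.trans_lt (by linarith)))

/-- **The support box lies in `𝒞`**: `{ϱ ≤ ρ₂, h₋ - δ/2 ≤ x₃ ≤ h₊ + δ/2} ⊆ 𝒞(0, 1)` when
`ρ₂ < 1`, `-1 ≤ h₋ - δ`, `h₊ + δ ≤ 1`, `δ > 0`. [folklore] -/
theorem box_subset_spaceCyl {ρ₂ hp hm δ : ℝ} (h₂ : ρ₂ < 1) (hδ : 0 < δ) (hm1 : -1 ≤ hm - δ)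
    (hp1 : hp + δ ≤ 1) :
    {x : EuclideanSpace ℝ (Fin 3) | cylRadius x ≤ ρ₂ ∧ hm - δ / 2 ≤ x 2 ∧ x 2 ≤ hp + δ / 2} ⊆
      SereginSverak2009.spaceCyl (0 : EuclideanSpace ℝ (Fin 3)) 1 := by
  rintro x ⟨hr, hl, hu⟩
  rw [SereginSverak2009.mem_spaceCyl, sub_zero]
  refine ⟨hr.trans_lt h₂, ?_⟩
  have : |x 2| < 1 := abs_lt.2 ⟨by linarith, by linarith⟩
  simpa using this

/-- The support box is closed. [folklore] -/
theorem isClosed_box (ρ₂ lo hi : ℝ) :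
    IsClosed {x : EuclideanSpace ℝ (Fin 3) | cylRadius x ≤ ρ₂ ∧ lo ≤ x 2 ∧ x 2 ≤ hi} := by
  have h2 : Continuous fun x : EuclideanSpace ℝ (Fin 3) => x 2 :=
    (EuclideanSpace.proj (2 : Fin 3)).continuous
  exact (isClosed_le continuous_cylRadius continuous_const).inter
    ((isClosed_le continuous_const h2).inter (isClosed_le h2 continuous_const))

/-- The gradient box is closed. [folklore] -/
theorem isClosed_gradBox (ρ₁ ρ₂ lo hi hp hm δ : ℝ) :
    IsClosed {x : EuclideanSpace ℝ (Fin 3) | cylRadius x ≤ ρ₂ ∧ lo ≤ x 2 ∧ x 2 ≤ hi ∧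
      (ρ₁ ≤ cylRadius x ∨ |x 2 - hp| ≤ δ / 2 ∨ |x 2 - hm| ≤ δ / 2)} := by
  have h2 : Continuous fun x : EuclideanSpace ℝ (Fin 3) => x 2 :=
    (EuclideanSpace.proj (2 : Fin 3)).continuous
  have e : {x : EuclideanSpace ℝ (Fin 3) | cylRadius x ≤ ρ₂ ∧ lo ≤ x 2 ∧ x 2 ≤ hi ∧
      (ρ₁ ≤ cylRadius x ∨ |x 2 - hp| ≤ δ / 2 ∨ |x 2 - hm| ≤ δ / 2)} =
      {x | cylRadius x ≤ ρ₂ ∧ lo ≤ x 2 ∧ x 2 ≤ hi} ∩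
        ({x | ρ₁ ≤ cylRadius x} ∪ ({x | |x 2 - hp| ≤ δ / 2} ∪ {x | |x 2 - hm| ≤ δ / 2})) := by
    ext x
    simp only [mem_setOf_eq, mem_inter_iff, mem_union]
    tauto
  rw [e]
  refine (isClosed_box ρ₂ lo hi).inter ((isClosed_le continuous_const continuous_cylRadius).union
    ((isClosed_le ?_ continuous_const).union (isClosed_le ?_ continuous_const)))
  · exact (h2.sub continuous_const).abs
  · exact (h2.sub continuous_const).abs

/-- The support box lies in the closed ball `B̄(0, 2)` (`ϱ ≤ ρ₂ < 1`, `|x₃| ≤ 1`). [folklore] -/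
theorem box_subset_closedBall {ρ₂ hp hm δ : ℝ} (h₂ : ρ₂ < 1) (hδ : 0 < δ) (hm1 : -1 ≤ hm - δ)
    (hp1 : hp + δ ≤ 1) :
    {x : EuclideanSpace ℝ (Fin 3) | cylRadius x ≤ ρ₂ ∧ hm - δ / 2 ≤ x 2 ∧ x 2 ≤ hp + δ / 2} ⊆
      closedBall (0 : EuclideanSpace ℝ (Fin 3)) 2 := by
  rintro x ⟨hr, hl, hu⟩
  have hρ₂ : 0 ≤ ρ₂ := (cylRadius_nonneg x).trans hr
  have h01 : x 0 ^ 2 + x 1 ^ 2 ≤ 1 := by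
    rw [← cylRadius_sq]
    have := pow_le_pow_left₀ (cylRadius_nonneg x) hr 2
    nlinarith
  have h2 : x 2 ^ 2 ≤ 1 := by
    have hl' : -1 ≤ x 2 := by linarith
    have hu' : x 2 ≤ 1 := by linarith
    nlinarith
  rw [mem_closedBall, dist_zero_right, EuclideanSpace.norm_eq, Fin.sum_univ_three]
  simp only [Real.norm_eq_abs, sq_abs]
  rw [Real.sqrt_le_iff]
  exact ⟨by norm_num, by nlinarith⟩

/-- The support box is compact (closed and bounded). [folklore] -/
theorem isCompact_box {ρ₂ hp hm δ : ℝ} (h₂ : ρ₂ < 1) (hδ : 0 < δ) (hm1 : -1 ≤ hm - δ)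
    (hp1 : hp + δ ≤ 1) :
    IsCompact {x : EuclideanSpace ℝ (Fin 3) | cylRadius x ≤ ρ₂ ∧ hm - δ / 2 ≤ x 2 ∧ x 2 ≤ hp + δ / 2} :=
  (isCompact_closedBall (0 : EuclideanSpace ℝ (Fin 3)) 2).of_isClosed_subset (isClosed_box _ _ _)
    (box_subset_closedBall h₂ hδ hm1 hp1)

end Geometry

/-! ### The cut-off -/

/-- **Seregin 2022, §2 Step 1: the spatial cut-off `ζ = φ(ϱ)ψ(x₃)` adapted to two regular
heights.** For radii `0 < ρ₁ < ρ₂ < 1` and heights/width `h₋, h₊, δ` with `δ > 0`,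
`-1 ≤ h₋ - δ`, `h₋ + δ < 0 < h₊ - δ`, `h₊ + δ ≤ 1` (the configuration of the core of
`seregin2022_logSwirl_regularAtOrigin_of_cleanRepr` at `(0, 1)`), there is `ζ : ℝ³ → ℝ` with:
`ζ ∈ C^∞`; `ζ` axisymmetric; compact support; `0 ≤ ζ ≤ 1`; `ζ = 1` on the closed box
`{ϱ ≤ ρ₁, h₋ + δ/2 ≤ x₃ ≤ h₊ - δ/2}`; `ζ ≠ 0` only in the open box
`{ϱ < ρ₂, h₋ - δ/2 < x₃ < h₊ + δ/2}`; `tsupport ζ ⊆ {ϱ ≤ ρ₂, h₋ - δ/2 ≤ x₃ ≤ h₊ + δ/2} ⊆ 𝒞`;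
and the location of `supp ∇ζ` ("in the set `supp |∇η|`, functions `v`, `∇v`, `∇²v` are
bounded"): `tsupport (∇ζ)` lies in the support box intersected with
`{ρ₁ ≤ ϱ} ∪ {|x₃ - h₊| ≤ δ/2} ∪ {|x₃ - h₋| ≤ δ/2}`, a compact set of points off the axis or
strictly within `δ` of one of the heights, and `∇ζ(x) ≠ 0` only at such points.
Witness: `ζ(x) = Θ_{ρ₁,ρ₂}(x₀² + x₁²) · Θ_{a,b}((x₃ - c)²)` with `c = (h₊ + h₋)/2`,
`a = (h₊ - h₋)/2 - δ/2`, `b = (h₊ - h₋)/2 + δ/2` (`Θ = cutoffProfile`). Registered sub-goal toward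
`stub_sereginLogSwirlOrigin`. [cite: Seregin2022LocalAxisym, §2 Step 1 (arXiv:2201.00153 p. 5), the cut-off η = φ(r)ψ(x₃)ξ(t) and supp|∇η|] -/
theorem exists_step1_cutoff : ∀ (ρ₁ ρ₂ hp hm δ : ℝ), 0 < ρ₁ → ρ₁ < ρ₂ → ρ₂ < 1 → 0 < δ → -1 ≤ hm - δ → hm + δ < 0 → 0 < hp - δ → hp + δ ≤ 1 → ∃ ζ : EuclideanSpace ℝ (Fin 3) → ℝ, ContDiff ℝ (⊤ : ℕ∞) ζ ∧ IsAxisymmetricScalar ζ ∧ HasCompactSupport ζ ∧ (∀ x, 0 ≤ ζ x ∧ ζ x ≤ 1) ∧ (∀ x, cylRadius x ≤ ρ₁ → hm + δ / 2 ≤ x 2 → x 2 ≤ hp - δ / 2 → ζ x = 1) ∧ (∀ x, ζ x ≠ 0 → cylRadius x < ρ₂ ∧ hm - δ / 2 < x 2 ∧ x 2 < hp + δ / 2) ∧ tsupport ζ ⊆ {x | cylRadius x ≤ ρ₂ ∧ hm - δ / 2 ≤ x 2 ∧ x 2 ≤ hp + δ / 2} ∧ tsupport ζ ⊆ SereginSverak2009.spaceCyl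 0 1 ∧ tsupport (fderiv ℝ ζ) ⊆ {x | cylRadius x ≤ ρ₂ ∧ hm - δ / 2 ≤ x 2 ∧ x 2 ≤ hp + δ / 2 ∧ (ρ₁ ≤ cylRadius x ∨ |x 2 - hp| ≤ δ / 2 ∨ |x 2 - hm| ≤ δ / 2)} ∧ (∀ x, fderiv ℝ ζ x ≠ 0 → ρ₁ ≤ cylRadius x ∨ |x 2 - hp| ≤ δ / 2 ∨ |x 2 - hm| ≤ δ / 2) := by
  intro ρ₁ ρ₂ hp hm δ h₁ h₁₂ h₂ hδ hm1 hm0 hp0 hp1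
  -- the parameters of the axial factor
  set c : ℝ := (hp + hm) / 2 with hc
  set a : ℝ := (hp - hm) / 2 - δ / 2 with ha
  set b : ℝ := (hp - hm) / 2 + δ / 2 with hb
  have ha0 : 0 ≤ a := by rw [ha]; linarith
  have hab : a < b := by rw [ha, hb]; linarith
  -- the two factors
  set φ : EuclideanSpace ℝ (Fin 3) → ℝ := fun x => cutoffProfile ρ₁ ρ₂ (x 0 ^ 2 + x 1 ^ 2) with hφ
  set ψ : EuclideanSpace ℝ (Fin 3) → ℝ := fun x => cutoffProfile a b ((x 2 - c) ^ 2) with hψ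
  obtain ⟨hφC, hφ01, hφ1, hφ0, hφrot⟩ := radialFactor_props h₁ h₁₂ (φ := φ) fun x => rfl
  obtain ⟨hψC, hψ01, hψ1, hψ0, hψrot⟩ := axialFactor_props ha0 hab (ψ := ψ) (c := c) fun x => rfl
  -- the axial plateau and support in terms of the heights
  have hψ1' : ∀ x : EuclideanSpace ℝ (Fin 3), hm + δ / 2 ≤ x 2 → x 2 ≤ hp - δ / 2 → ψ x = 1 :=
    fun x hl hu => hψ1 x (abs_le.2 ⟨by rw [ha, hc]; linarith, by rw [ha, hc]; linarith⟩)
  have hψ0l : ∀ x : EuclideanSpace ℝ (Fin 3), x 2 ≤ hm - δ / 2 → ψ x = 0 := fun x hx =>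
    hψ0 x (by rw [hb, hc, abs_sub_comm]; exact le_abs.2 (Or.inl (by linarith)))
  have hψ0u : ∀ x : EuclideanSpace ℝ (Fin 3), hp + δ / 2 ≤ x 2 → ψ x = 0 := fun x hx =>
    hψ0 x (by rw [hb, hc]; exact le_abs.2 (Or.inl (by linarith)))
  -- values: nonzero only in the open box, one on the plateau box
  have hnz : ∀ x : EuclideanSpace ℝ (Fin 3), φ x * ψ x ≠ 0 →
      cylRadius x < ρ₂ ∧ hm - δ / 2 < x 2 ∧ x 2 < hp + δ / 2 := by
    intro x hx
    refine ⟨?_, ?_, ?_⟩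
    · by_contra h
      exact hx (by rw [hφ0 x (not_lt.1 h), zero_mul])
    · by_contra h
      exact hx (by rw [hψ0l x (not_lt.1 h), mul_zero])
    · by_contra h
      exact hx (by rw [hψ0u x (not_lt.1 h), mul_zero])
  have hts : tsupport (fun x => φ x * ψ x) ⊆
      {x | cylRadius x ≤ ρ₂ ∧ hm - δ / 2 ≤ x 2 ∧ x 2 ≤ hp + δ / 2} := by
    refine closure_minimal (fun x hx => ?_) (isClosed_box _ _ _)
    obtain ⟨h1, h2, h3⟩ := hnz x (mem_support.1 hx)
    exact ⟨h1.le, h2.le, h3.le⟩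
  have hts1 : tsupport (fun x => φ x * ψ x) ⊆ SereginSverak2009.spaceCyl 0 1 :=
    hts.trans (box_subset_spaceCyl h₂ hδ hm1 hp1)
  -- the gradient vanishes on the open exterior and on the open plateau
  have hcont2 : Continuous fun x : EuclideanSpace ℝ (Fin 3) => x 2 :=
    (EuclideanSpace.proj (2 : Fin 3)).continuous
  have hD0 : ∀ x : EuclideanSpace ℝ (Fin 3), (ρ₂ < cylRadius x ∨ x 2 < hm - δ / 2 ∨ hp + δ / 2 < x 2) →
      fderiv ℝ (fun x => φ x * ψ x) x = 0 := by
    intro x hx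
    have hO : IsOpen {y : EuclideanSpace ℝ (Fin 3) | ρ₂ < cylRadius y ∨ y 2 < hm - δ / 2 ∨ hp + δ / 2 < y 2} :=
      (isOpen_lt continuous_const continuous_cylRadius).union
        ((isOpen_lt hcont2 continuous_const).union (isOpen_lt continuous_const hcont2))
    refine fderiv_eq_zero_of_eqOn_isOpen hO (c := 0) (fun y hy => ?_) hx
    by_contra h
    obtain ⟨h1, h2, h3⟩ := hnz y h
    rcases hy with hy | hy | hy <;> linarith
  have hD1 : ∀ x : EuclideanSpace ℝ (Fin 3), (cylRadius x < ρ₁ ∧ hm + δ / 2 < x 2 ∧ x 2 < hp - δ / 2) →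
      fderiv ℝ (fun x => φ x * ψ x) x = 0 := by
    intro x hx
    have hO : IsOpen {y : EuclideanSpace ℝ (Fin 3) | cylRadius y < ρ₁ ∧ hm + δ / 2 < y 2 ∧ y 2 < hp - δ / 2} :=
      (isOpen_lt continuous_cylRadius continuous_const).inter
        ((isOpen_lt continuous_const hcont2).inter (isOpen_lt hcont2 continuous_const))
    refine fderiv_eq_zero_of_eqOn_isOpen hO (c := 1) (fun y hy => ?_) hx
    obtain ⟨hy1, hy2, hy3⟩ := hy
    rw [hφ1 y hy1.le, hψ1' y hy2.le hy3.le, one_mul]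
  have hgrad : ∀ x : EuclideanSpace ℝ (Fin 3), fderiv ℝ (fun x => φ x * ψ x) x ≠ 0 →
      cylRadius x ≤ ρ₂ ∧ hm - δ / 2 ≤ x 2 ∧ x 2 ≤ hp + δ / 2 ∧
        (ρ₁ ≤ cylRadius x ∨ |x 2 - hp| ≤ δ / 2 ∨ |x 2 - hm| ≤ δ / 2) := by
    intro x hx
    have h0 : ¬ (ρ₂ < cylRadius x ∨ x 2 < hm - δ / 2 ∨ hp + δ / 2 < x 2) := fun h => hx (hD0 x h)
    have h1 : ¬ (cylRadius x < ρ₁ ∧ hm + δ / 2 < x 2 ∧ x 2 < hp - δ / 2) := fun h => hx (hD1 x h)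
    simp only [not_or, not_lt, not_and] at h0 h1
    obtain ⟨h01, h02, h03⟩ := h0
    refine ⟨h01, h02, h03, ?_⟩
    by_cases hr : ρ₁ ≤ cylRadius x
    · exact Or.inl hr
    · right
      by_cases hl : x 2 ≤ hm + δ / 2
      · exact Or.inr (abs_le.2 ⟨by linarith, by linarith⟩)
      · have hu : hp - δ / 2 ≤ x 2 := h1 (not_le.1 hr) (not_le.1 hl)
        exact Or.inl (abs_le.2 ⟨by linarith, by linarith⟩)
  -- the cut-off
  refine ⟨fun x => φ x * ψ x, hφC.mul hψC, ?_, ?_, ?_, ?_, hnz, hts, hts1, ?_, fun x hx => (hgrad x hx).2.2.2⟩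
  · -- axisymmetry
    intro θ x
    show φ (rotZ θ x) * ψ (rotZ θ x) = φ x * ψ x
    rw [hφrot, hψrot]
  · -- compact support
    exact (isCompact_box h₂ hδ hm1 hp1).of_isClosed_subset (isClosed_tsupport _) hts
  · -- values in `[0, 1]`
    intro x
    obtain ⟨h1, h2⟩ := hφ01 x
    obtain ⟨h3, h4⟩ := hψ01 x
    exact ⟨mul_nonneg h1 h3, by nlinarith⟩
  · -- plateau
    intro x hx hl hu
    show φ x * ψ x = 1
    rw [hφ1 x hx, hψ1' x hl hu, one_mul]
  · -- support of the gradient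
    exact closure_minimal (fun x hx => hgrad x (mem_support.1 hx)) (isClosed_gradBox _ _ _ _ _ _ _)

end Summit.NavierStokesRegularity.NavierStokesRegularity.Theorems.AxisymmetricKatoGlobal.EulerScaling

end
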